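import Summits.Ventures.LatticeQCDFlow.Scoring.NonabelianAreaLaw2DNestedLoops
import Summits.Ventures.LatticeQCDFlow.Scoring.UNWilsonLoopSecondMoment2D
import HarnessLib

/-!
# The exact correlation of two NESTED two-dimensional `U(N)` Wilson loops: `⟨tr W_{R×T} · conj tr W_{R'×T}⟩_β = P_N(β)^{(R−R')T}·(1 + (N²−1)·P_adj(β)^{R'T})`

HONEST FRAMING: exact (Metropolis-corrected) sampling algorithms for lattice gauge theory;
figures of merit are autocorrelation/cost numbers at stated couplings and volumes; no
continuum-physics claim.

Venture `LatticeQCDFlow` (cell pub-lqcd), sub-topic `Scoring`; FANOUT row 5 (`s0-sun-a`), GEN-21.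
NEW WORK of the cell (placement rule).  For the free-boundary `R × T` lattice of two-dimensional `U(N)` lattice
Yang–Mills (`N ≥ 2`, every real `β`, weight `e^{−β(N − Re tr U_p)}`, realised in `(ℤ/L)²`, `R + 1 ≤ L`, `T + 1 ≤ L`)
and the two loops `W = W_{R×T}`, `W' = W_{R'×T}` with common corner and height, `R = R' + k`:

  **`⟨tr W · conj(tr W')⟩_β = P_N(β)^{kT} · (1 + (N² − 1)·P_adj(β)^{R'T})`**,

`P_N = ∫N⁻¹Re tr u·e^{−β(N−Re tr u)}du / ∫e^{−β(N−Re tr u)}du` (GEN-18's one-plaquette plaquette),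
`P_adj = (M₂/D − 1)/(N² − 1)` (GEN-21).  With the means `⟨tr W⟩ = N·P_N^{RT}`, `⟨tr W'⟩ = N·P_N^{R'T}` (GEN-18) this
is the exact covariance `Cov_β(tr W, tr W') = P_N^{kT}(1 + (N²−1)P_adj^{R'T}) − N²·P_N^{(R+R')T}` of two nested loops —
the input of the error propagation of Creutz ratios in two dimensions; `k = 0` is `UNWilsonLoopSecondMoment2D`.
Route: GEN-21's nested area law (`NonabelianAreaLaw2DNestedLoops`, `ρ = u`, `σ = ū`), Schur for the outer factor
(`M_ρ = m·1`, GEN-18's `unitary_integralMatrix_eq_smul_one`), and `tr M_{u⊗ū}^{R'T} = D^{R'T} + (N²−1)A^{R'T}` (GEN-21).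

* `unitary_open_trace_mul_conj_trace_nested_integral_eq` (unnormalised), **`unitary_open_trace_mul_conj_trace_nested_eq`**.

No `def`, nothing cited as a fact, 0 sorry.
-/

noncomputable section

open MeasureTheory Function Finset
open Literature.MathematicalPhysics.QuantumFieldTheory
open Literature.MathematicalPhysics.QuantumLattice
open Summit.Ventures.LatticeQCDFlow.Theory2.Lattice
open Summit.Ventures.LatticeQCDFlow.Theory2.Lattice.TwoDim
open Literature.Analysis.FunctionSpaces (besselI)
open scoped Kronecker

namespace Summit.Ventures.LatticeQCDFlow.Scoring

section Nested

variable {L : ℕ} [NeZero L] {N : ℕ}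

/-- **THE UNNORMALISED NESTED CORRELATION** (`U(N)`, `N ≥ 2`, `R = R' + k`, `R + 1 ≤ L`, `T + 1 ≤ L`):
`∫ tr W_{R×T} · conj(tr W_{R'×T}) ∏_{p∈B_{R×T}} e^{−β(N−Re tr U_p)} = m^{kT} · e^{−NβR'T}·(D^{R'T} + (N²−1)A^{R'T})`,
`m = N⁻¹∫Re tr u·e^{−β(N−Re tr u)}du` the scalar of the one-plaquette matrix. -/
theorem unitary_open_trace_mul_conj_trace_nested_integral_eq (hN : 2 ≤ N) (β : ℝ) (i j : ZMod L) {R' k T : ℕ}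
    (hR : R' + k + 1 ≤ L) (hT : T + 1 ≤ L) :
    ∫ U, ((rectangleHolonomy U ![i, j] 0 1 (R' + k) T : Matrix.unitaryGroup (Fin N) ℂ) : Matrix (Fin N) (Fin N) ℂ).trace *
        (starRingEnd ℂ) ((rectangleHolonomy U ![i, j] 0 1 R' T : Matrix.unitaryGroup (Fin N) ℂ) :
          Matrix (Fin N) (Fin N) ℂ).trace *
        ∏ p ∈ (range (R' + k) ×ˢ range T).image (fun q : ℕ × ℕ => (![i + q.1, j + q.2] : Site 2 L)),
          (Real.exp (-(β * ((N : ℝ) - ((plaquetteHolonomy U p 0 1 : Matrix.unitaryGroup (Fin N) ℂ) :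
            Matrix (Fin N) (Fin N) ℂ).trace.re))) : ℂ)
        ∂(Measure.pi fun _ : Edge 2 L => haarProbability (Matrix.unitaryGroup (Fin N) ℂ)) =
      (((N : ℝ)⁻¹ * ∫ u, ((u : Matrix.unitaryGroup (Fin N) ℂ) : Matrix (Fin N) (Fin N) ℂ).trace.re *
          Real.exp (-(β * ((N : ℝ) - ((u : Matrix.unitaryGroup (Fin N) ℂ) : Matrix (Fin N) (Fin N) ℂ).trace.re)))
          ∂(haarProbability (Matrix.unitaryGroup (Fin N) ℂ)) : ℝ) : ℂ) ^ (k * T) *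
        ((Real.exp (-(N * β)) : ℂ) ^ (R' * T) *
          ((((Matrix.of fun i j : Fin N => besselI ((i : ℤ) - (j : ℤ)).natAbs β).det : ℝ) : ℂ) ^ (R' * T) +
            ((N : ℂ) ^ 2 - 1) *
              ((((∫ u, (‖((u : Matrix.unitaryGroup (Fin N) ℂ) : Matrix (Fin N) (Fin N) ℂ).trace‖ ^ 2 : ℝ) *
                  Real.exp (β * ((u : Matrix.unitaryGroup (Fin N) ℂ) : Matrix (Fin N) (Fin N) ℂ).trace.re)
                  ∂(haarProbability (Matrix.unitaryGroup (Fin N) ℂ))) -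
                  (Matrix.of fun i j : Fin N => besselI ((i : ℤ) - (j : ℤ)).natAbs β).det) / ((N : ℝ) ^ 2 - 1) : ℝ) : ℂ) ^
                (R' * T))) := by
  set ρ := unitaryFundamentalRep (Fin N) ℂ with hρ
  set σ : Matrix.unitaryGroup (Fin N) ℂ →* Matrix (Fin N) (Fin N) ℂ :=
    ((starRingEnd ℂ).mapMatrix : Matrix (Fin N) (Fin N) ℂ →+* Matrix (Fin N) (Fin N) ℂ).toMonoidHom.comp
      (unitaryFundamentalRep (Fin N) ℂ) with hσ
  have hσa : ∀ g : Matrix.unitaryGroup (Fin N) ℂ, σ g = ((g : Matrix.unitaryGroup (Fin N) ℂ) : Matrix (Fin N) (Fin N) ℂ).map (starRingEnd ℂ) :=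
    fun g => rfl
  have hw : Continuous fun u : Matrix.unitaryGroup (Fin N) ℂ =>
      Real.exp (-(β * ((N : ℝ) - ((u : Matrix.unitaryGroup (Fin N) ℂ) : Matrix (Fin N) (Fin N) ℂ).trace.re))) := by
    fun_prop
  have hF : Continuous fun x : ℝ => Real.exp (-(β * ((N : ℝ) - x))) := by fun_prop
  -- the nested area law, entrywise, summed over the two diagonals
  have hnest := integral_rep_rectangleHolonomy_mul_rep_inner_mul_prod_weight (L := L) ρ σ
    (continuous_unitaryFundamentalRep (Fin N) ℂ) (continuous_conj_unitaryFundamentalRep N) hw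
    (unitary_wilsonWeight_conj N β) i j hT R'
  -- the outer one-plaquette matrix is scalar
  set m : ℝ := (N : ℝ)⁻¹ * ∫ u, ((u : Matrix.unitaryGroup (Fin N) ℂ) : Matrix (Fin N) (Fin N) ℂ).trace.re *
      Real.exp (-(β * ((N : ℝ) - ((u : Matrix.unitaryGroup (Fin N) ℂ) : Matrix (Fin N) (Fin N) ℂ).trace.re)))
      ∂(haarProbability (Matrix.unitaryGroup (Fin N) ℂ)) with hm
  have hM : (Matrix.of fun k l : Fin N => ∫ g, ρ g k l *
      (Real.exp (-(β * ((N : ℝ) - ((g : Matrix.unitaryGroup (Fin N) ℂ) : Matrix (Fin N) (Fin N) ℂ).trace.re))) : ℂ)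
        ∂(haarProbability (Matrix.unitaryGroup (Fin N) ℂ))) = (m : ℂ) • (1 : Matrix (Fin N) (Fin N) ℂ) := by
    simp only [hρ, unitaryFundamentalRep_apply]
    exact unitary_integralMatrix_eq_smul_one N hF
  -- the inner Kronecker matrix splits off `e^{−Nβ}`
  have hsplit : ∀ u : Matrix.unitaryGroup (Fin N) ℂ,
      (Real.exp (-(β * ((N : ℝ) - ((u : Matrix.unitaryGroup (Fin N) ℂ) : Matrix (Fin N) (Fin N) ℂ).trace.re))) : ℂ) =
        (Real.exp (-(N * β)) : ℂ) *
          (Real.exp (β * ((u : Matrix.unitaryGroup (Fin N) ℂ) : Matrix (Fin N) (Fin N) ℂ).trace.re) : ℂ) := by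
    intro u; rw [← Complex.ofReal_mul, ← Real.exp_add]; congr 2; ring
  have hX : (Matrix.of fun k l : Fin N × Fin N => ∫ g, (ρ g ⊗ₖ σ g) k l *
        (Real.exp (-(β * ((N : ℝ) - ((g : Matrix.unitaryGroup (Fin N) ℂ) : Matrix (Fin N) (Fin N) ℂ).trace.re))) : ℂ)
        ∂(haarProbability (Matrix.unitaryGroup (Fin N) ℂ))) =
      (Real.exp (-(N * β)) : ℂ) • (Matrix.of fun k l : Fin N × Fin N => ∫ u,
        (((u : Matrix.unitaryGroup (Fin N) ℂ) : Matrix (Fin N) (Fin N) ℂ) ⊗ₖ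
          (((u : Matrix.unitaryGroup (Fin N) ℂ) : Matrix (Fin N) (Fin N) ℂ).map (starRingEnd ℂ))) k l *
        (Real.exp (β * ((u : Matrix.unitaryGroup (Fin N) ℂ) : Matrix (Fin N) (Fin N) ℂ).trace.re) : ℂ)
        ∂(haarProbability (Matrix.unitaryGroup (Fin N) ℂ))) := by
    ext k l
    simp only [Matrix.of_apply, Matrix.smul_apply, smul_eq_mul, hσa, hρ, unitaryFundamentalRep_apply, hsplit]
    rw [← integral_const_mul]
    exact integral_congr_ae (ae_of_all _ fun u => by ring)
  -- continuity / integrability of the integrand pieces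
  have hW : ∀ R₀ : ℕ, Continuous fun U : GaugeConfig 2 L (Matrix.unitaryGroup (Fin N) ℂ) =>
      ((rectangleHolonomy U ![i, j] 0 1 R₀ T : Matrix.unitaryGroup (Fin N) ℂ) : Matrix (Fin N) (Fin N) ℂ).trace :=
    fun R₀ => (continuous_unitaryFundamentalRep (Fin N) ℂ).matrix_trace.comp (continuous_config_rectangleHolonomy _ 0 1 R₀ T)
  have hΨc : Continuous fun U : GaugeConfig 2 L (Matrix.unitaryGroup (Fin N) ℂ) =>
      ∏ p ∈ (range (R' + k) ×ˢ range T).image (fun q : ℕ × ℕ => (![i + q.1, j + q.2] : Site 2 L)),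
        (Real.exp (-(β * ((N : ℝ) - ((plaquetteHolonomy U p 0 1 : Matrix.unitaryGroup (Fin N) ℂ) :
          Matrix (Fin N) (Fin N) ℂ).trace.re))) : ℂ) :=
    continuous_finsetProd _ fun p _ => Complex.continuous_ofReal.comp (hw.comp (continuous_config_plaquetteHolonomy p 0 1))
  have hint : ∀ a c : Fin N, Integrable (fun U : GaugeConfig 2 L (Matrix.unitaryGroup (Fin N) ℂ) =>
      ρ (rectangleHolonomy U ![i, j] 0 1 (R' + k) T) a a * σ (rectangleHolonomy U ![i, j] 0 1 R' T) c c *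
        ∏ p ∈ (range (R' + k) ×ˢ range T).image (fun q : ℕ × ℕ => (![i + q.1, j + q.2] : Site 2 L)),
          (Real.exp (-(β * ((N : ℝ) - ((plaquetteHolonomy U p 0 1 : Matrix.unitaryGroup (Fin N) ℂ) :
            Matrix (Fin N) (Fin N) ℂ).trace.re))) : ℂ))
      (Measure.pi fun _ : Edge 2 L => haarProbability (Matrix.unitaryGroup (Fin N) ℂ)) := fun a c =>
    integrable_gaugeConfig_of_continuous (((((continuous_unitaryFundamentalRep (Fin N) ℂ).comp
      (continuous_config_rectangleHolonomy _ 0 1 (R' + k) T)).matrix_elem a a).mul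
      (((continuous_conj_unitaryFundamentalRep N).comp (continuous_config_rectangleHolonomy _ 0 1 R' T)).matrix_elem c c)).mul hΨc)
  -- expand tr · conj tr into diagonal entries
  have hpt : ∀ U : GaugeConfig 2 L (Matrix.unitaryGroup (Fin N) ℂ),
      ((rectangleHolonomy U ![i, j] 0 1 (R' + k) T : Matrix.unitaryGroup (Fin N) ℂ) : Matrix (Fin N) (Fin N) ℂ).trace *
        (starRingEnd ℂ) ((rectangleHolonomy U ![i, j] 0 1 R' T : Matrix.unitaryGroup (Fin N) ℂ) :
          Matrix (Fin N) (Fin N) ℂ).trace *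
        ∏ p ∈ (range (R' + k) ×ˢ range T).image (fun q : ℕ × ℕ => (![i + q.1, j + q.2] : Site 2 L)),
          (Real.exp (-(β * ((N : ℝ) - ((plaquetteHolonomy U p 0 1 : Matrix.unitaryGroup (Fin N) ℂ) :
            Matrix (Fin N) (Fin N) ℂ).trace.re))) : ℂ) =
      ∑ a, ∑ c, ρ (rectangleHolonomy U ![i, j] 0 1 (R' + k) T) a a * σ (rectangleHolonomy U ![i, j] 0 1 R' T) c c *
        ∏ p ∈ (range (R' + k) ×ˢ range T).image (fun q : ℕ × ℕ => (![i + q.1, j + q.2] : Site 2 L)),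
          (Real.exp (-(β * ((N : ℝ) - ((plaquetteHolonomy U p 0 1 : Matrix.unitaryGroup (Fin N) ℂ) :
            Matrix (Fin N) (Fin N) ℂ).trace.re))) : ℂ) := by
    intro U
    rw [← trace_map_starRingEnd, Matrix.trace, Matrix.trace, Finset.sum_mul, Finset.sum_mul]
    refine Finset.sum_congr rfl fun a _ => ?_
    rw [Matrix.diag_apply, Finset.mul_sum, Finset.sum_mul]
    rfl
  rw [integral_congr_ae (ae_of_all _ hpt), integral_finsetSum _ fun a _ => integrable_finsetSum _ fun c _ => hint a c]
  simp_rw [integral_finsetSum _ fun c _ => hint _ c]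
  set X : Matrix (Fin N × Fin N) (Fin N × Fin N) ℂ := Matrix.of fun k l : Fin N × Fin N => ∫ u,
        (((u : Matrix.unitaryGroup (Fin N) ℂ) : Matrix (Fin N) (Fin N) ℂ) ⊗ₖ
          (((u : Matrix.unitaryGroup (Fin N) ℂ) : Matrix (Fin N) (Fin N) ℂ).map (starRingEnd ℂ))) k l *
        (Real.exp (β * ((u : Matrix.unitaryGroup (Fin N) ℂ) : Matrix (Fin N) (Fin N) ℂ).trace.re) : ℂ)
        ∂(haarProbability (Matrix.unitaryGroup (Fin N) ℂ)) with hXdef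
  have hterm : ∀ a c : Fin N,
      ∫ U, ρ (rectangleHolonomy U ![i, j] 0 1 (R' + k) T) a a * σ (rectangleHolonomy U ![i, j] 0 1 R' T) c c *
        ∏ p ∈ (range (R' + k) ×ˢ range T).image (fun q : ℕ × ℕ => (![i + q.1, j + q.2] : Site 2 L)),
          (Real.exp (-(β * ((N : ℝ) - ((plaquetteHolonomy U p 0 1 : Matrix.unitaryGroup (Fin N) ℂ) :
            Matrix (Fin N) (Fin N) ℂ).trace.re))) : ℂ)
        ∂(Measure.pi fun _ : Edge 2 L => haarProbability (Matrix.unitaryGroup (Fin N) ℂ)) =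
      (m : ℂ) ^ (k * T) * ((Real.exp (-(N * β)) : ℂ) ^ (R' * T) * (X ^ (R' * T)) (a, c) (a, c)) := by
    intro a c
    rw [hnest c c k hR a a, hM, hX, smul_pow, smul_pow, one_pow]
    simp only [Matrix.smul_apply, Matrix.one_apply, smul_eq_mul, mul_ite, mul_one, mul_zero, ite_mul, zero_mul,
      Finset.sum_ite_eq, Finset.mem_univ, if_true]
  simp_rw [hterm, ← Finset.mul_sum]
  rw [← Fintype.sum_prod_type' (f := fun a c => (X ^ (R' * T)) (a, c) (a, c))]
  have htr : ∑ x : Fin N × Fin N, (X ^ (R' * T)) (x.1, x.2) (x.1, x.2) = (X ^ (R' * T)).trace := by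
    rw [Matrix.trace]; rfl
  rw [htr, hXdef, unitary_trace_kroneckerConj_integral_pow hN β (R' * T)]


/-- **THE EXACT CORRELATION OF TWO NESTED `U(N)` WILSON LOOPS** (`N ≥ 2`, every real `β`, `R = R' + k`,
`R + 1 ≤ L`, `T + 1 ≤ L`): `⟨tr W_{R×T} · conj(tr W_{R'×T})⟩_β = P_N(β)^{kT} · (1 + (N² − 1)·P_adj(β)^{R'T})`, with
`P_N = (N⁻¹∫Re tr u·e^{−β(N−Re tr u)}du)/(∫e^{−β(N−Re tr u)}du)` and `P_adj = (M₂/D − 1)/(N² − 1)`. -/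
theorem unitary_open_trace_mul_conj_trace_nested_eq (hN : 2 ≤ N) (β : ℝ) (i j : ZMod L) {R' k T : ℕ}
    (hR : R' + k + 1 ≤ L) (hT : T + 1 ≤ L) :
    (∫ U, ((rectangleHolonomy U ![i, j] 0 1 (R' + k) T : Matrix.unitaryGroup (Fin N) ℂ) : Matrix (Fin N) (Fin N) ℂ).trace *
        (starRingEnd ℂ) ((rectangleHolonomy U ![i, j] 0 1 R' T : Matrix.unitaryGroup (Fin N) ℂ) :
          Matrix (Fin N) (Fin N) ℂ).trace *
        ∏ p ∈ (range (R' + k) ×ˢ range T).image (fun q : ℕ × ℕ => (![i + q.1, j + q.2] : Site 2 L)),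
          (Real.exp (-(β * ((N : ℝ) - ((plaquetteHolonomy U p 0 1 : Matrix.unitaryGroup (Fin N) ℂ) :
            Matrix (Fin N) (Fin N) ℂ).trace.re))) : ℂ)
        ∂(Measure.pi fun _ : Edge 2 L => haarProbability (Matrix.unitaryGroup (Fin N) ℂ))) /
      ((∫ U, ∏ p ∈ (range (R' + k) ×ˢ range T).image (fun q : ℕ × ℕ => (![i + q.1, j + q.2] : Site 2 L)),
          Real.exp (-(β * ((N : ℝ) - ((plaquetteHolonomy U p 0 1 : Matrix.unitaryGroup (Fin N) ℂ) :
            Matrix (Fin N) (Fin N) ℂ).trace.re)))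
        ∂(Measure.pi fun _ : Edge 2 L => haarProbability (Matrix.unitaryGroup (Fin N) ℂ)) : ℝ) : ℂ) =
      ((((N : ℝ)⁻¹ * ∫ u, ((u : Matrix.unitaryGroup (Fin N) ℂ) : Matrix (Fin N) (Fin N) ℂ).trace.re *
          Real.exp (-(β * ((N : ℝ) - ((u : Matrix.unitaryGroup (Fin N) ℂ) : Matrix (Fin N) (Fin N) ℂ).trace.re)))
          ∂(haarProbability (Matrix.unitaryGroup (Fin N) ℂ))) /
          (∫ u, Real.exp (-(β * ((N : ℝ) - ((u : Matrix.unitaryGroup (Fin N) ℂ) : Matrix (Fin N) (Fin N) ℂ).trace.re)))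
            ∂(haarProbability (Matrix.unitaryGroup (Fin N) ℂ))) : ℝ) : ℂ) ^ (k * T) *
        (1 + ((N : ℂ) ^ 2 - 1) *
          ((((∫ u, (‖((u : Matrix.unitaryGroup (Fin N) ℂ) : Matrix (Fin N) (Fin N) ℂ).trace‖ ^ 2 : ℝ) *
              Real.exp (β * ((u : Matrix.unitaryGroup (Fin N) ℂ) : Matrix (Fin N) (Fin N) ℂ).trace.re)
              ∂(haarProbability (Matrix.unitaryGroup (Fin N) ℂ))) /
              (Matrix.of fun i j : Fin N => besselI ((i : ℤ) - (j : ℤ)).natAbs β).det - 1) / ((N : ℝ) ^ 2 - 1) : ℝ) : ℂ) ^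
            (R' * T)) := by
  set M₂ : ℝ := ∫ u, (‖((u : Matrix.unitaryGroup (Fin N) ℂ) : Matrix (Fin N) (Fin N) ℂ).trace‖ ^ 2 : ℝ) *
    Real.exp (β * ((u : Matrix.unitaryGroup (Fin N) ℂ) : Matrix (Fin N) (Fin N) ℂ).trace.re)
    ∂(haarProbability (Matrix.unitaryGroup (Fin N) ℂ)) with hM₂
  set D : ℝ := (Matrix.of fun i j : Fin N => besselI ((i : ℤ) - (j : ℤ)).natAbs β).det with hD
  set m : ℝ := (N : ℝ)⁻¹ * ∫ u, ((u : Matrix.unitaryGroup (Fin N) ℂ) : Matrix (Fin N) (Fin N) ℂ).trace.re *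
      Real.exp (-(β * ((N : ℝ) - ((u : Matrix.unitaryGroup (Fin N) ℂ) : Matrix (Fin N) (Fin N) ℂ).trace.re)))
      ∂(haarProbability (Matrix.unitaryGroup (Fin N) ℂ)) with hm
  have hDpos : 0 < D := det_besselI_toeplitz_fin_pos N β
  -- the one-plaquette partition function `Z₁ = e^{−Nβ} D`
  have hZ1 : ∫ u, Real.exp (-(β * ((N : ℝ) - ((u : Matrix.unitaryGroup (Fin N) ℂ) : Matrix (Fin N) (Fin N) ℂ).trace.re)))
      ∂(haarProbability (Matrix.unitaryGroup (Fin N) ℂ)) = Real.exp (-(N * β)) * D := by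
    have hsplit : ∀ u : Matrix.unitaryGroup (Fin N) ℂ,
        Real.exp (-(β * ((N : ℝ) - ((u : Matrix.unitaryGroup (Fin N) ℂ) : Matrix (Fin N) (Fin N) ℂ).trace.re))) =
          Real.exp (-(N * β)) * Real.exp (β * ((u : Matrix.unitaryGroup (Fin N) ℂ) : Matrix (Fin N) (Fin N) ℂ).trace.re) := by
      intro u; rw [← Real.exp_add]; congr 1; ring
    simp_rw [hsplit]
    rw [integral_const_mul, integral_haar_unitaryGroup_fin_exp_mul_trace_re]
  have hE : (0 : ℝ) < Real.exp (-(N * β)) := Real.exp_pos _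
  rw [unitary_open_partitionFunction_eq N β i j hR hT,
    unitary_open_trace_mul_conj_trace_nested_integral_eq (L := L) hN β i j hR hT, ← hM₂, ← hD, ← hm, hZ1]
  have hN1 : ((N : ℝ) ^ 2 - 1) ≠ 0 := by
    have h2 : (2 : ℝ) ≤ N := by exact_mod_cast hN
    nlinarith
  have hE0 : (Real.exp (-(N * β)) : ℂ) ≠ 0 := by exact_mod_cast hE.ne'
  have hD0 : (D : ℂ) ≠ 0 := by exact_mod_cast hDpos.ne'
  -- pure algebra
  have key : ∀ (mm e d c a : ℂ) (n₁ n₂ : ℕ), e ≠ 0 → d ≠ 0 →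
      mm ^ n₁ * (e ^ n₂ * (d ^ n₂ + c * a ^ n₂)) / ((e * d) ^ (n₂ + n₁)) = (mm / (e * d)) ^ n₁ * (1 + c * (a / d) ^ n₂) := by
    intro mm e d c a n₁ n₂ he hd
    rw [pow_add, mul_pow, mul_pow, div_pow, div_pow, mul_pow]
    field_simp
  have ha : (((M₂ / D - 1) / ((N : ℝ) ^ 2 - 1) : ℝ) : ℂ) = (((M₂ - D) / ((N : ℝ) ^ 2 - 1) : ℝ) : ℂ) / (D : ℂ) := by
    rw [← Complex.ofReal_div]; congr 1; field_simp
  have hq : (((m / (Real.exp (-(N * β)) * D)) : ℝ) : ℂ) = (m : ℂ) / ((Real.exp (-(N * β)) : ℂ) * (D : ℂ)) := by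
    push_cast; ring
  have hz : ((((Real.exp (-(N * β)) * D) ^ ((R' + k) * T)) : ℝ) : ℂ) =
      ((Real.exp (-(N * β)) : ℂ) * (D : ℂ)) ^ (R' * T + k * T) := by
    rw [Complex.ofReal_pow, Complex.ofReal_mul, show (R' + k) * T = R' * T + k * T by ring]
  rw [ha, hq, hz]
  exact key _ _ _ _ _ _ _ hE0 hD0

end Nested

end Summit.Ventures.LatticeQCDFlow.Scoring
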